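import Literature.AnabelianGeometry.EtaleTheta.Discharge.Sec5FactsMembersAtThetaSettingYdd
import Literature.AnabelianGeometry.EtaleTheta.Discharge.Sec5Lem59iiOfConnectedTemperoidData

/-!
# [EtTh] §5 (pp. 330–331) / Lemma 5.9 (i)(ii): the section laws of the §5 data OF THE SETTING (`ofThetaSettingData` over `mkOfThetaSettingYdd`,
# `A_⊙^bs := Ÿ̲̲`) — F-0537 / F-0542 / F-0551 / F-0552 / F-0553 / F-0555 / F-0737, NO hypothesis beyond the data

S. Mochizuki, *The étale theta function and its Frobenioid-theoretic manifestations*, Publ. RIMS **45** (2009), §5 pp. 330–331 (the sections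
`s^⊓-gp_N`, `s^⊔-gp_N`, `s^trv_N`), Lemma 5.9 (i), (ii) pp. 331–332 (PDF pp. 105–106), Prop. 5.2 (iii) p. 324 [cite: MochizukiEtTh2009, §5 p.330–332
(PDF pp.104–106)].

abc-iut cell, D-0079 ORIGINAL-L / L-F [EtTh] (FACT rows F-0537 `ENExact`, F-0542 `SectionsFactor`, F-0551 `BiKummerDifferenceMem`, F-0552 `SgpCapSpec`,
F-0553 `SgpCupSpec`, F-0555 `StrvSection`, F-0737 `AutAmpleBN`; nodes `EtTh:§5-data`, `EtTh:Lem5.9(i)(ii)`), seat abc-iut-w6-d053 (gen 5), sequel of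
`Sec5FactsMembersAtThetaSettingYdd.lean` (p461358) for the census `LF-ETTH-S5A/S5B.tsv`.  PROOF-ONLY (0 definitions, no instance, no new `Prop`):
the generic Ÿ-data / connected-temperoid closers of abc-iut-L2-t4 (`Sec5OfConnectedTemperoid.lean`: `strvSection_…`, `sgpCapSpec_…`, `sgpCupSpec_…`,
`autAmpleBN_ofConnectedTemperoidData`) and abc-iut-w6-d054 (`Sec5Lem59iiOfConnectedTemperoidData.lean`: `enExact_…`, `sectionsFactor_…`,
`biKummerDifferenceMem_ofConnectedTemperoidYddData`) read AT THE SETTING'S OWN §5 DATA through `ofThetaSettingData_eq` (`rfl`) and the abbrev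
`mkOfThetaSettingYdd`.  Everything BY NAME; nothing landed is edited or restated.
HONEST FRAMING: kernel re-keying at the junction; `tf` is an abstract parameter; nothing here bears on [IUTchIII] Cor. 3.12; no side taken;
typed ≠ proved.
-/

noncomputable section

namespace Literature.AnabelianGeometry.EtaleTheta

open CategoryTheory Opposite Literature.AlgebraicGeometry.Frobenioids Literature.AnabelianGeometry.SemiGraphs

universe v₀

namespace ThetaFrobenioid

variable {p : ℕ} [Fact p.Prime] {D : ThetaSetting p} {E : D.EtaleThetaData} {l : ℕ} {C : E.DoubleUnderline l}
  {e : D.toTemperedCurve.GroupLevelData} {N : ℕ+} (μ : D.CyclotomeMod l N) (hC : D.Compat) (hS : D.Sec2Hyps)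
  {D₀ : Type} [Category.{v₀} D₀] {V : FrdIMonoidStub.{0}} {T₀ : RealifiedDivisorMonoids (D₀ := D₀) V}
  {VD : FrdICatStub.{1, 0, 0} (ConnectedPart (BTemp (C.temperedArithmeticGroup e).Pi))}
  {tf : TemperedFrobenioid T₀ (ConnectedPart (BTemp (C.temperedArithmeticGroup e).Pi)) VD} {hZ : tf.monoidType = MonoidType.Z}
  {hP : ∀ A : (ConnectedPart (BTemp (C.temperedArithmeticGroup e).Pi))ᵒᵖ, IsPerfect (tf.Φ.carrier A)}
  {NH : Subgroup (Field.absoluteGaloisGroup D.K) → tf.category → ℕ+ → Prop}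
  {pullFrac : ∀ {A A' : (BiKummerSetting.mkOfThetaSettingYdd C e μ hC hS tf hZ hP NH).C} (_ : A' ⟶ A),
    (BiKummerSetting.mkOfThetaSettingYdd C e μ hC hS tf hZ hP NH).biratUnits A →
      (BiKummerSetting.mkOfThetaSettingYdd C e μ hC hS tf hZ hP NH).biratUnits A'}
  {θ : (BiKummerSetting.mkOfThetaSettingYdd C e μ hC hS tf hZ hP NH).biratUnits (BiKummerSetting.mkOfThetaSettingYdd C e μ hC hS tf hZ hP NH).Aodot}
  {Bl : (BiKummerSetting.mkOfThetaSettingYdd C e μ hC hS tf hZ hP NH).C}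
  {Pl : (BiKummerSetting.mkOfThetaSettingYdd C e μ hC hS tf hZ hP NH).FractionPair θ Bl}
  {Rl : (BiKummerSetting.mkOfThetaSettingYdd C e μ hC hS tf hZ hP NH).NthRoot θ Pl C.lPNat pullFrac}
  (h : ModelFrobenioid.Hypotheses tf.divisorMonoid tf.ratFnFunctor)
  (Q : FrobenioidTheta.ThetaSubquotientStub.{0} (ConnectedPart (BTemp (C.temperedArithmeticGroup e).Pi)))
  (R : (BiKummerSetting.mkOfThetaSettingYdd C e μ hC hS tf hZ hP NH).NthRoot Rl.root Rl.pair N pullFrac)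
  (K' : Type) [Field K'] (constEmb : K'ˣ →* tf.biratUnitsModel R.BN) (constEmb_injective : Function.Injective constEmb)
  (hinvc : ∀ g : Aut R.AN.base,
    pull tf.divisorMonoid g.hom (ModelFrobenioid.div R.pair.num) = ModelFrobenioid.div R.pair.num)
  (hinvp : ∀ y : (C.thetaEnvData μ hC hS).PiX, y ∈ (C.thetaEnvData μ hC hS).PiYdd →
    pull tf.divisorMonoid ((BiKummerSetting.mkOfThetaSettingYdd C e μ hC hS tf hZ hP NH).galoisSurj
      R.AN.base R.αData.isGalois ((ContinuousMulEquiv.refl _) y)).hom (ModelFrobenioid.div R.pair.den) = ModelFrobenioid.div R.pair.den)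

/-- **F-0555 `StrvSection` (§5 p.331: `s^trv_N` IS a section — CONSTRUCTED `strvOfBiKummerData`) at the §5 data of the Setting (`A_⊙^bs := Ÿ̲̲`), NO hypothesis beyond the data.** [cite: MochizukiEtTh2009, §5 p.331 (PDF p.105)] -/
theorem strvSection_ofThetaSettingYddData :
    (ofThetaSettingData μ hC hS h Q R K' constEmb constEmb_injective hinvc hinvp).StrvSection :=
  strvSection_ofConnectedTemperoidData (T := C.thetaEnvData μ hC hS) h Q C.odd_lPNat R (ContinuousMulEquiv.refl _) K' constEmb constEmb_injective hinvc hinvp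

/-- **F-0552 `SgpCapSpec` (`s^⊓-gp_N` restricted to `H_{B_N}` is `s^trv_N`) at the §5 data of the Setting (`A_⊙^bs := Ÿ̲̲`), NO hypothesis beyond the data.** [cite: MochizukiEtTh2009, §5 p.331 (PDF p.105)] -/
theorem sgpCapSpec_ofThetaSettingYddData :
    (ofThetaSettingData μ hC hS h Q R K' constEmb constEmb_injective hinvc hinvp).SgpCapSpec :=
  sgpCapSpec_ofConnectedTemperoidData (T := C.thetaEnvData μ hC hS) h Q C.odd_lPNat R (ContinuousMulEquiv.refl _) K' constEmb constEmb_injective hinvc hinvp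

/-- **F-0553 `SgpCupSpec` at the §5 data of the Setting (`A_⊙^bs := Ÿ̲̲`), NO hypothesis beyond the data.** [cite: MochizukiEtTh2009, §5 p.331 (PDF p.105)] -/
theorem sgpCupSpec_ofThetaSettingYddData :
    (ofThetaSettingData μ hC hS h Q R K' constEmb constEmb_injective hinvc hinvp).SgpCupSpec :=
  sgpCupSpec_ofConnectedTemperoidData (T := C.thetaEnvData μ hC hS) h Q C.odd_lPNat R (ContinuousMulEquiv.refl _) K' constEmb constEmb_injective hinvc hinvp

/-- **F-0737 `AutAmpleBN` (`B_N` Aut-ample) at the §5 data of the Setting (`A_⊙^bs := Ÿ̲̲`), NO hypothesis beyond the data.** [cite: MochizukiEtTh2009, §5 p.330 (PDF p.104)] -/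
theorem autAmpleBN_ofThetaSettingYddData :
    (ofThetaSettingData μ hC hS h Q R K' constEmb constEmb_injective hinvc hinvp).AutAmpleBN :=
  autAmpleBN_ofConnectedTemperoidData (T := C.thetaEnvData μ hC hS) h Q C.odd_lPNat R (ContinuousMulEquiv.refl _) K' constEmb constEmb_injective hinvc hinvp

/-- **F-0537 `ENExact` (Lemma 5.9 (ii): `1 → K^× → E_N → Π^tp_X·… → 1` exact) at the §5 data of the Setting (`A_⊙^bs := Ÿ̲̲`), NO hypothesis beyond the data.** [cite: MochizukiEtTh2009, Lem 5.9 (ii) p.332 (PDF p.106)] -/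
theorem enExact_ofThetaSettingYddData :
    (ofThetaSettingData μ hC hS h Q R K' constEmb constEmb_injective hinvc hinvp).ENExact :=
  enExact_ofConnectedTemperoidYddData (T := C.thetaEnvData μ hC hS) h Q C.odd_lPNat R K' constEmb constEmb_injective hinvc hinvp

/-- **F-0542 `SectionsFactor` (Lemma 5.9 (i): the two Kummer sections factor through `E_N`) at the §5 data of the Setting (`A_⊙^bs := Ÿ̲̲`), NO hypothesis beyond the data.** [cite: MochizukiEtTh2009, Lem 5.9 (i) p.331 (PDF p.105)] -/
theorem sectionsFactor_ofThetaSettingYddData :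
    (ofThetaSettingData μ hC hS h Q R K' constEmb constEmb_injective hinvc hinvp).SectionsFactor :=
  sectionsFactor_ofConnectedTemperoidYddData (T := C.thetaEnvData μ hC hS) h Q C.odd_lPNat R K' constEmb constEmb_injective hinvc hinvp

/-- **F-0551 `BiKummerDifferenceMem` (Prop. 5.2 (iii) / 4.3 (iii): the bi-Kummer difference cocycle lies in `μ_N(B_N)`) at the §5 data of the Setting (`A_⊙^bs := Ÿ̲̲`), NO hypothesis beyond the data.** [cite: MochizukiEtTh2009, Prop 5.2 (iii) p.324 (PDF p.98)] -/
theorem biKummerDifferenceMem_ofThetaSettingYddData :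
    (ofThetaSettingData μ hC hS h Q R K' constEmb constEmb_injective hinvc hinvp).BiKummerDifferenceMem :=
  biKummerDifferenceMem_ofConnectedTemperoidYddData (T := C.thetaEnvData μ hC hS) h Q C.odd_lPNat R K' constEmb constEmb_injective hinvc hinvp

end ThetaFrobenioid

end Literature.AnabelianGeometry.EtaleTheta

end
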